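/-
Copyright: the b2b-balaban cell (near-miss cell 7), T⁴-continuum CRUX team (coordinator ruling e34b3e0c item (2)),
seat t4-ne7b-formalise-leaf-06 (gen 26). Released under the licence of the surrounding project.
-/
import Summits.QuantumFields.YangMills.Theorems.ParabolicTrajectoryLatticeGapOnTrajectoryLargeFieldSparse
import Summits.QuantumFields.YangMills.Theorems.LangevinControlUVFemtoCurvatureTwoPointCUniformDoublingAll
import Literature.MathematicalPhysics.QuantumFieldTheory.WilsonEnergyConvexity
import HarnessLib

/-!
# Local exponential plaquette moments of Wilson's lattice gauge measure at weak coupling, uniformly in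
# the volume (route NE7b R-T1, rung 0 = prediction P1-a of `t4/ROUTES-NE7b.md`)

Cell `pub-balaban`, sub-cell `t4`, spine estimate NE7b (node U5c), candidate route R-T1 «Markov–Chebyshev
chain bound» of `t4/ROUTES-NE7b.md` v1 (seat `t4-ne7b-idea-1`). That route's one new analytic input is
(LS), a LOCAL MULTIPLICATIVE exponential-moment bound for block plaquette energies; its rung 0 — the
route's FIRST REFUTABLE PREDICTION P1-a — is the statement for the BARE Wilson measure:

  `E_β[exp(a·β·∑_{p ∈ Q} A_p)] ≤ exp(C·a·|Q|)`, `A_p = N − Re tr r(U_p) ≥ 0`, `0 ≤ a ≤ ½`,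

with ONE constant `C = C(r)` for all `β ≥ 4`, all tori and all finite plaquette sets `Q` — plaquette
energies have exponential moments at the natural scale `1/β`, locally (the exponent is linear in
`a|Q|`, not in the volume). This file PROVES it (kernel, no hypothesis, no `def … : Prop`) for every
compact gauge group `G` with a faithful continuous unitary lattice representation `r` (e.g. `SU(2)`,
fundamental), in `d = 4`, on every ODD torus `(ℤ/(2S+1))⁴`, `S ≥ 1`, for the plaquettes of one
orientation class `o` (`localExpMoment_class`). The sibling module `…NE7b.LocalPlaquetteExpMomentsAll`
derives the bound for arbitrary plaquette sets (`0 ≤ a ≤ 1/12`, Jensen over the `K₀ = 6` classes) and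
the corollary «MEAN PLAQUETTE ENERGY `≤ C'/β` uniformly in the volume».

Proof = assembly of three tree theorems:
* the four-direction TILT CHESSBOARD on the odd four-torus
  (`…LatticeGapOnTrajectory.SparseDefectOrbitWindow.tiltChessboard`, Fröhlich–Israel–Lieb–Simon 1978 in
  the tilt form): `E[e^{aβ∑_{x∈Q}A_{(x,o)}}] ≤ (E[e^{aβ∑_{x}A_{(x,o)}}])^{|Q|/L⁴}`;
* `E_β[e^{aβ S}] = Z((1−a)β)/Z(β)` and CONVEXITY of `log Z` (`convexOn_torusLogPartition`):
  `log Z((1−a)β) − log Z(β) ≤ 2a (log Z(β/2) − log Z(β))`;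
* UNIFORM TORUS DOUBLING (`…FemtoCurvatureTwoPointC.TorusGauge.uniformDoubling_all`):
  `Z_L(β/2) ≤ e^{A L⁴} Z_L(β)` for all `L ≥ 2`, `β ≥ 4`.

HONEST FRAMING. This is rung 0 of (LS) only (the bare measure, scale `j = 0`); (LS) at scales `j ≥ 1`
(block-averaged fields) is the route's open XL input and is NOT touched. NE7b
(`T4WeightBudget.RelWeightBound`) is NOT PRINTED in [Bałaban 1983–89] and NOT PROVED; spine PROVED 0∕9;
rung (B)+1 on a FINITE torus T⁴ — NOT infinite volume, NOT the mass gap, NOT Clay.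
HONEST DEPENDENCY: continuum YM on T⁴ ⇐ BetaPertH ∧ nine spine estimates (0/9 proved); BetaPertH ⇐ (D1) ∧
(D4) ∧ CAP+tail; G-an2-4 gates asym, D1 and NE2/3/4.

## References (for the assembled inputs)

* J. Fröhlich, R. Israel, E. H. Lieb, B. Simon, Comm. Math. Phys. 62 (1978) 1–34, Thm. 2.2 / 4.1.
* S. Chatterjee, J. Funct. Anal. 271 (2016) 2944–3005 (arXiv:1602.01222), Thm. 2.1 (free energy).
* E. Seiler, LNP 159 (1982), Ch. 2–3 (chessboard estimates in lattice gauge theory).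
-/

set_option autoImplicit false

noncomputable section

namespace Summit.QuantumFields.BalabanUV.T4Continuum.NE7b.LocalPlaquetteExpMoments

open scoped BigOperators
open MeasureTheory
open Literature.MathematicalPhysics.QuantumFieldTheory
open Literature.MathematicalPhysics.QuantumLattice (torusLogPartition)
open Summit.QuantumFields.YangMills.Cruxes.LatticeGapOnTrajectory.SparseDefectOrbitWindow (tiltChessboard)
open Summit.QuantumFields.YangMills.Theorems.FemtoCurvatureTwoPointC.TorusGauge (uniformDoubling_all)
open Summit.QuantumFields.YangMills.Theorems.FemtoCurvatureTwoPoint.PlaquetteVariance (partitionFunction_toReal_pos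
  card_site)

variable {G : Type} [Group G] [TopologicalSpace G] [IsTopologicalGroup G] [CompactSpace G]
  [MeasurableSpace G] [BorelSpace G]


/-! ## §1 Pointwise facts: plaquette energies are non-negative and bounded, one class is below the action -/

section Pointwise

variable {N L : ℕ} [NeZero L] (ρ : G →* Matrix (Fin N) (Fin N) ℂ)

omit [NeZero L] [MeasurableSpace G] [BorelSpace G] in
/-- `0 ≤ N − Re tr ρ(U_p)`. -/
theorem plaqEnergy_nonneg (hρ : Continuous ρ) (U : GaugeConfig 4 L G) (p : Plaquette 4 L) :
    0 ≤ (N : ℝ) - WilsonRP.plaqRe ρ U p := by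
  have h := (abs_le.1 (WilsonRP.abs_plaqRe_le ρ hρ U p)).2
  linarith

omit [NeZero L] [MeasurableSpace G] [BorelSpace G] in
/-- `N − Re tr ρ(U_p) ≤ 2N`. -/
theorem plaqEnergy_le (hρ : Continuous ρ) (U : GaugeConfig 4 L G) (p : Plaquette 4 L) :
    (N : ℝ) - WilsonRP.plaqRe ρ U p ≤ 2 * N := by
  have h := (abs_le.1 (WilsonRP.abs_plaqRe_le ρ hρ U p)).1
  linarith

omit [TopologicalSpace G] [IsTopologicalGroup G] [CompactSpace G] [MeasurableSpace G] [BorelSpace G] in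
/-- The Wilson action is the sum of the plaquette energies. -/
theorem wilsonAction_eq_sum_plaqEnergy (U : GaugeConfig 4 L G) :
    wilsonAction ρ U = ∑ p : Plaquette 4 L, ((N : ℝ) - WilsonRP.plaqRe ρ U p) := rfl

omit [MeasurableSpace G] [BorelSpace G] in
/-- The plaquette energies of ONE orientation class sum to at most the Wilson action. -/
theorem sum_class_le_wilsonAction (hρ : Continuous ρ) (o : {q : Fin 4 × Fin 4 // q.1 < q.2}) (U : GaugeConfig 4 L G) :
    ∑ x : Site 4 L, ((N : ℝ) - WilsonRP.plaqRe ρ U (x, o)) ≤ wilsonAction ρ U := by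
  rw [wilsonAction_eq_sum_plaqEnergy, Fintype.sum_prod_type]
  exact Finset.sum_le_sum fun x _ =>
    Finset.single_le_sum (f := fun o' : {q : Fin 4 × Fin 4 // q.1 < q.2} => (N : ℝ) - WilsonRP.plaqRe ρ U (x, o'))
      (fun o' _ => plaqEnergy_nonneg ρ hρ U (x, o')) (Finset.mem_univ o)

omit [NeZero L] [MeasurableSpace G] [BorelSpace G] in
/-- A sum of plaquette energies over a set of sites of one class is between `0` and `2N · #Q`. -/
theorem abs_sum_plaqEnergy_le (hρ : Continuous ρ) (o : {q : Fin 4 × Fin 4 // q.1 < q.2}) (Q : Finset (Site 4 L))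
    (U : GaugeConfig 4 L G) :
    |∑ x ∈ Q, ((N : ℝ) - WilsonRP.plaqRe ρ U (x, o))| ≤ 2 * N * Q.card := by
  rw [abs_of_nonneg (Finset.sum_nonneg fun x _ => plaqEnergy_nonneg ρ hρ U (x, o))]
  calc ∑ x ∈ Q, ((N : ℝ) - WilsonRP.plaqRe ρ U (x, o)) ≤ ∑ _x ∈ Q, (2 * (N : ℝ)) :=
        Finset.sum_le_sum fun x _ => plaqEnergy_le ρ hρ U (x, o)
    _ = 2 * N * Q.card := by rw [Finset.sum_const, nsmul_eq_mul]; ring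

end Pointwise

/-! ## §2 Integrals against the Wilson measure: `E_β[e^{tS}] = Z(β−t)/Z(β)` and the one-class bound -/

section Integrals

variable {N L : ℕ} [NeZero L] (ρ : G →* Matrix (Fin N) (Fin N) ℂ)

/-- A measurable observable bounded in absolute value has an integrable exponential under the Wilson
measure. -/
theorem integrable_exp_of_abs_le (hρ : Continuous ρ) (β : ℝ) {g : GaugeConfig 4 L G → ℝ}
    (hg : Measurable g) {B : ℝ} (hB : ∀ U, |g U| ≤ B) :
    Integrable (fun U => Real.exp (g U)) (wilsonMeasure (d := 4) (L := L) ρ β) := by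
  haveI := isProbabilityMeasure_wilsonMeasure (d := 4) (L := L) (G := G) ρ hρ β
  refine Integrable.of_bound (Real.measurable_exp.comp hg).aestronglyMeasurable (Real.exp B)
    (ae_of_all _ fun U => ?_)
  rw [Real.norm_eq_abs, Real.abs_exp]
  exact Real.exp_le_exp.2 ((le_abs_self _).trans (hB U))

omit [CompactSpace G] [NeZero L] in
/-- Measurability of a tilted class sum `U ↦ t · ∑_{x ∈ Q} (N − Re tr ρ(U_{(x,o)}))`. -/
theorem measurable_mul_sum_plaqEnergy (hρ : Continuous ρ) (t : ℝ) (o : {q : Fin 4 × Fin 4 // q.1 < q.2}) (Q : Finset (Site 4 L)) :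
    Measurable fun U : GaugeConfig 4 L G => t * ∑ x ∈ Q, ((N : ℝ) - WilsonRP.plaqRe ρ U (x, o)) :=
  (Finset.measurable_sum Q fun x _ =>
    measurable_const.sub (WilsonRP.measurable_plaqRe ρ hρ (x, o))).const_mul t

/-- **`E_β[e^{tS}] = Z(β − t)/Z(β)`** (Gibbs average against product Haar measure). -/
theorem integral_exp_mul_wilsonAction (hρ : Continuous ρ) (β t : ℝ) :
    ∫ U, Real.exp (t * wilsonAction ρ U) ∂(wilsonMeasure (d := 4) (L := L) ρ β) =
      (partitionFunction (d := 4) (L := L) ρ (β - t)).toReal /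
        (partitionFunction (d := 4) (L := L) ρ β).toReal := by
  have h := wilsonExpectation_eq_integral_div (d := 4) (L := L) ρ hρ β
    (fun U => Real.exp (t * wilsonAction ρ U))
  unfold wilsonExpectation at h
  rw [h, partitionFunction_toReal_eq_integral ρ hρ, partitionFunction_toReal_eq_integral ρ hρ]
  congr 1
  refine integral_congr_ae (ae_of_all _ fun U => ?_)
  beta_reduce
  rw [← Real.exp_add]
  congr 1
  ring

/-- **The exponential moment of one orientation class is at most `Z((1−a)β)/Z(β)`**:
`E_β[exp(aβ ∑ₓ (N − Re tr ρ(U_{(x,o)})))] ≤ Z(β − aβ)/Z(β)` for `aβ ≥ 0` (the other classes have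
non-negative energies). -/
theorem integral_exp_class_le_ratio (hρ : Continuous ρ) (β : ℝ) {t : ℝ} (ht : 0 ≤ t) (o : {q : Fin 4 × Fin 4 // q.1 < q.2}) :
    ∫ U, Real.exp (t * ∑ x : Site 4 L, ((N : ℝ) - WilsonRP.plaqRe ρ U (x, o)))
        ∂(wilsonMeasure (d := 4) (L := L) ρ β) ≤
      (partitionFunction (d := 4) (L := L) ρ (β - t)).toReal /
        (partitionFunction (d := 4) (L := L) ρ β).toReal := by
  haveI := isProbabilityMeasure_wilsonMeasure (d := 4) (L := L) (G := G) ρ hρ β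
  rw [← integral_exp_mul_wilsonAction ρ hρ β t]
  refine integral_mono ?_ (integrable_exp_mul_wilsonAction ρ hρ t _) fun U => ?_
  · refine integrable_exp_of_abs_le ρ hρ β (measurable_mul_sum_plaqEnergy ρ hρ t o Finset.univ)
      (B := |t| * (2 * N * (Finset.univ : Finset (Site 4 L)).card)) fun U => ?_
    rw [abs_mul]
    exact mul_le_mul_of_nonneg_left (abs_sum_plaqEnergy_le ρ hρ o _ U) (abs_nonneg t)
  · exact Real.exp_le_exp.2 (mul_le_mul_of_nonneg_left (sum_class_le_wilsonAction ρ hρ o U) ht)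

/-- `Z(β') / Z(β) = exp(log Z(β') − log Z(β))`. -/
theorem ratio_eq_exp_sub (hρ : Continuous ρ) (β β' : ℝ) :
    (partitionFunction (d := 4) (L := L) ρ β').toReal / (partitionFunction (d := 4) (L := L) ρ β).toReal =
      Real.exp (torusLogPartition 4 ρ β' L - torusLogPartition 4 ρ β L) := by
  have h1 := partitionFunction_toReal_pos (d := 4) (L := L) ρ hρ β
  have h2 := partitionFunction_toReal_pos (d := 4) (L := L) ρ hρ β'
  rw [Real.exp_sub, torusLogPartition, torusLogPartition, Real.exp_log h1, Real.exp_log h2]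

/-- **Convexity interpolation**: `log Z((1−a)β) ≤ (1 − 2a) log Z(β) + 2a log Z(β/2)` for
`0 ≤ a ≤ ½` (`(1−a)β = (1−2a)·β + 2a·(β/2)` and `log Z` is convex in `β`). -/
theorem torusLogPartition_interp (hρ : Continuous ρ) (β : ℝ) {a : ℝ} (ha0 : 0 ≤ a) (ha : a ≤ 1 / 2) :
    torusLogPartition 4 ρ ((1 - a) * β) L ≤
      (1 - 2 * a) * torusLogPartition 4 ρ β L + 2 * a * torusLogPartition 4 ρ (β / 2) L := by
  have hc := (convexOn_torusLogPartition (d := 4) (L := L) ρ hρ).2 (Set.mem_univ β)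
    (Set.mem_univ (β / 2)) (show (0 : ℝ) ≤ 1 - 2 * a by linarith) (show (0 : ℝ) ≤ 2 * a by linarith)
    (show (1 - 2 * a) + 2 * a = 1 by ring)
  simp only [smul_eq_mul] at hc
  have hβ : (1 - 2 * a) * β + 2 * a * (β / 2) = (1 - a) * β := by ring
  rw [hβ] at hc
  exact hc

end Integrals

/-! ## §3 Uniform doubling in logarithmic form and the one-class moment bound `≤ e^{2aAL⁴}` -/

section Doubling

/-- **Uniform torus doubling, logarithmic form**: for a faithful continuous unitary lattice
representation `r` of a compact group there is `A ≥ 0` with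
`log Z_L(b/2) ≤ A L⁴ + log Z_L(b)` for all `L ≥ 2`, `b ≥ 4` (tree `uniformDoubling_all`; second
countability of `G` follows from the closed embedding `r.ρ`). -/
theorem exists_log_doubling (r : LatticeRep G) :
    ∃ A : ℝ, 0 ≤ A ∧ ∀ (L : ℕ) [NeZero L] (b : ℝ), 2 ≤ L → 4 ≤ b →
      torusLogPartition 4 r.ρ (b / 2) L ≤ A * (L : ℝ) ^ 4 + torusLogPartition 4 r.ρ b L := by
  haveI : SecondCountableTopology (Matrix (Fin r.N) (Fin r.N) ℂ) :=
    inferInstanceAs (SecondCountableTopology (Fin r.N → Fin r.N → ℂ))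
  haveI : SecondCountableTopology G :=
    (r.continuous.isClosedEmbedding r.injective).isEmbedding.secondCountableTopology
  obtain ⟨A, hA⟩ := uniformDoubling_all r
  refine ⟨max A 0, le_max_right _ _, fun L _ b hL hb => ?_⟩
  have hZ := partitionFunction_toReal_pos (d := 4) (L := L) r.ρ
    r.continuous b
  have hZ2 := partitionFunction_toReal_pos (d := 4) (L := L) r.ρ
    r.continuous (b / 2)
  have h := hA L b hL hb
  have h' : (partitionFunction (d := 4) (L := L) r.ρ (b / 2)).toReal ≤
      Real.exp (max A 0 * (L : ℝ) ^ 4) * (partitionFunction (d := 4) (L := L) r.ρ b).toReal :=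
    h.trans (mul_le_mul_of_nonneg_right
      (Real.exp_le_exp.2 (mul_le_mul_of_nonneg_right (le_max_left _ _) (by positivity))) hZ.le)
  have hlog := Real.log_le_log hZ2 h'
  rw [Real.log_mul (Real.exp_pos _).ne' hZ.ne', Real.log_exp] at hlog
  exact hlog

/-- **The exponential moment of one full orientation class**: with `A` from `exists_log_doubling`,
`E_β[exp(aβ ∑ₓ (N − Re tr r(U_{(x,o)})))] ≤ exp(2aA·L⁴)` for `L ≥ 2`, `β ≥ 4`, `0 ≤ a ≤ ½`. -/
theorem integral_exp_class_le_exp (r : LatticeRep G) {A : ℝ}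
    (hA : ∀ (L : ℕ) [NeZero L] (b : ℝ), 2 ≤ L → 4 ≤ b →
      torusLogPartition 4 r.ρ (b / 2) L ≤ A * (L : ℝ) ^ 4 + torusLogPartition 4 r.ρ b L)
    {L : ℕ} [NeZero L] (hL : 2 ≤ L) {β : ℝ} (hβ : 4 ≤ β) {a : ℝ} (ha0 : 0 ≤ a) (ha : a ≤ 1 / 2)
    (o : {q : Fin 4 × Fin 4 // q.1 < q.2}) :
    ∫ U, Real.exp (a * β * ∑ x : Site 4 L, ((r.N : ℝ) - WilsonRP.plaqRe r.ρ U (x, o)))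
        ∂(wilsonMeasure (d := 4) (L := L) r.ρ β) ≤ Real.exp (2 * a * A * (L : ℝ) ^ 4) := by
  have ht : 0 ≤ a * β := mul_nonneg ha0 (by linarith)
  refine (integral_exp_class_le_ratio r.ρ r.continuous β ht o).trans ?_
  rw [ratio_eq_exp_sub r.ρ r.continuous, show β - a * β = (1 - a) * β by ring]
  refine Real.exp_le_exp.2 ?_
  have h1 := torusLogPartition_interp (L := L) r.ρ r.continuous β ha0 ha
  have h2 := hA L β hL hβ
  nlinarith

end Doubling

/-! ## §4 The local bound for one orientation class (chessboard) -/

section Local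

/-- **LOCAL EXPONENTIAL PLAQUETTE MOMENTS, ONE ORIENTATION CLASS (P1-a of route NE7b R-T1).** For a
faithful continuous unitary lattice representation `r` of a compact group `G` there is `C ≥ 0` such
that for every odd torus `(ℤ/(2S+1))⁴` with `S ≥ 1`, every `β ≥ 4`, every `0 ≤ a ≤ ½`, every
orientation class `o` and every finite set of sites `Q`:
`∫ exp(a·β·∑_{x∈Q} (N − Re tr r(U_{(x,o)}))) dμ_β ≤ exp(C·a·#Q)`. -/
theorem localExpMoment_class (r : LatticeRep G) :
    ∃ C : ℝ, 0 ≤ C ∧ ∀ (S : ℕ), 1 ≤ S → ∀ (β : ℝ), 4 ≤ β → ∀ (a : ℝ), 0 ≤ a → a ≤ 1 / 2 →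
      ∀ (o : {q : Fin 4 × Fin 4 // q.1 < q.2}) (Q : Finset (Site 4 (2 * S + 1))),
        ∫ U, Real.exp (a * β * ∑ x ∈ Q, ((r.N : ℝ) - WilsonRP.plaqRe r.ρ U (x, o)))
            ∂(wilsonMeasure r.ρ β : Measure (GaugeConfig 4 (2 * S + 1) G)) ≤
          Real.exp (C * a * Q.card) := by
  obtain ⟨A, hA0, hA⟩ := exists_log_doubling r
  refine ⟨2 * A, by positivity, fun S hS β hβ a ha0 ha o Q => ?_⟩
  haveI hprob := isProbabilityMeasure_wilsonMeasure (d := 4) (L := 2 * S + 1) (G := G) r.ρ r.continuous β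
  have hT2 : 2 ≤ 2 * S + 1 := by omega
  have hβ0 : 0 ≤ β := by linarith
  have hab : 0 ≤ a * β := mul_nonneg ha0 hβ0
  -- the tilt profile `aβ · 1_Q` and the chessboard estimate for it
  let c : Site 4 (2 * S + 1) → ℝ := fun x => if x ∈ Q then a * β else 0
  have hc0 : ∀ x, 0 ≤ c x := fun x => by
    simp only [c]; split_ifs <;> [exact hab; exact le_rfl]
  have hcβ : ∀ x, c x ≤ β := fun x => by
    simp only [c]; split_ifs <;> nlinarith
  have hchess := tiltChessboard S r.N G r.ρ hS r.continuous β hβ0 o c hc0 hcβ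
  -- notation: the measure, the observable of the statement, the full-class observable, the integral
  set μ : Measure (GaugeConfig 4 (2 * S + 1) G) := wilsonMeasure r.ρ β with hμ
  set E : GaugeConfig 4 (2 * S + 1) G → ℝ :=
    fun U => ∑ x ∈ Q, ((r.N : ℝ) - WilsonRP.plaqRe r.ρ U (x, o)) with hE
  set F : GaugeConfig 4 (2 * S + 1) G → ℝ :=
    fun U => ∑ x : Site 4 (2 * S + 1), ((r.N : ℝ) - WilsonRP.plaqRe r.ρ U (x, o)) with hF
  change ∫ U, Real.exp (a * β * E U) ∂μ ≤ Real.exp (2 * A * a * Q.card)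
  set I : ℝ := ∫ U, Real.exp (a * β * E U) ∂μ with hI
  have hI0 : 0 ≤ I := integral_nonneg fun U => (Real.exp_pos _).le
  -- LHS integrand: `exp(−∑ c·Re tr) = exp(−aβN#Q) · exp(aβ E)`
  have hLHS : ∀ U : GaugeConfig 4 (2 * S + 1) G,
      Real.exp (-∑ x : Site 4 (2 * S + 1), c x * WilsonRP.plaqRe r.ρ U (x, o)) =
        Real.exp (-(a * β * r.N * Q.card)) * Real.exp (a * β * E U) := by
    intro U
    rw [← Real.exp_add]
    congr 1
    have hsum : ∑ x : Site 4 (2 * S + 1), c x * WilsonRP.plaqRe r.ρ U (x, o) =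
        a * β * ∑ x ∈ Q, WilsonRP.plaqRe r.ρ U (x, o) := by
      simp only [c, ite_mul, zero_mul, Finset.sum_ite_mem, Finset.univ_inter, ← Finset.mul_sum]
    have hE' : E U = (r.N : ℝ) * Q.card - ∑ x ∈ Q, WilsonRP.plaqRe r.ρ U (x, o) := by
      simp only [hE, Finset.sum_sub_distrib, Finset.sum_const, nsmul_eq_mul]; ring
    rw [hsum, hE']
    ring
  have hLHSint : ∫ U, Real.exp (-∑ x : Site 4 (2 * S + 1), c x * WilsonRP.plaqRe r.ρ U (x, o)) ∂μ =
      Real.exp (-(a * β * r.N * Q.card)) * I := by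
    simp_rw [hLHS]
    rw [integral_const_mul]
  -- RHS factors: `y ∈ Q` gives the full-class moment, `y ∉ Q` gives `1`
  have hfull : ∀ U : GaugeConfig 4 (2 * S + 1) G,
      Real.exp (-∑ x : Site 4 (2 * S + 1), a * β * WilsonRP.plaqRe r.ρ U (x, o)) =
        Real.exp (-(a * β * r.N * ((2 * S + 1 : ℕ) : ℝ) ^ 4)) * Real.exp (a * β * F U) := by
    intro U
    rw [← Real.exp_add]
    congr 1
    have hsum : ∑ x : Site 4 (2 * S + 1), a * β * WilsonRP.plaqRe r.ρ U (x, o) =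
        a * β * ∑ x : Site 4 (2 * S + 1), WilsonRP.plaqRe r.ρ U (x, o) := by rw [← Finset.mul_sum]
    have hF' : F U = (r.N : ℝ) * ((2 * S + 1 : ℕ) : ℝ) ^ 4 -
        ∑ x : Site 4 (2 * S + 1), WilsonRP.plaqRe r.ρ U (x, o) := by
      simp only [hF, Finset.sum_sub_distrib, Finset.sum_const, Finset.card_univ, card_site, nsmul_eq_mul,
        Nat.cast_pow]; ring
    rw [hsum, hF']
    ring
  have hB : ∫ U, Real.exp (a * β * F U) ∂μ ≤ Real.exp (2 * a * A * ((2 * S + 1 : ℕ) : ℝ) ^ 4) :=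
    integral_exp_class_le_exp r hA hT2 hβ ha0 ha o
  have hRHS : ∀ y : Site 4 (2 * S + 1),
      ∫ U, Real.exp (-∑ x : Site 4 (2 * S + 1), c y * WilsonRP.plaqRe r.ρ U (x, o)) ∂μ ≤
        if y ∈ Q then Real.exp (-(a * β * r.N * ((2 * S + 1 : ℕ) : ℝ) ^ 4)) *
            Real.exp (2 * a * A * ((2 * S + 1 : ℕ) : ℝ) ^ 4)
        else 1 := by
    intro y
    by_cases hy : y ∈ Q
    · simp only [c, hy, ↓reduceIte]
      simp_rw [hfull]
      rw [integral_const_mul]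
      exact mul_le_mul_of_nonneg_left hB (Real.exp_pos _).le
    · simp only [c, hy, ↓reduceIte, zero_mul, Finset.sum_const_zero, neg_zero, Real.exp_zero]
      rw [integral_const, smul_eq_mul, mul_one, probReal_univ]
  have hRHS0 : ∀ y : Site 4 (2 * S + 1),
      0 ≤ ∫ U, Real.exp (-∑ x : Site 4 (2 * S + 1), c y * WilsonRP.plaqRe r.ρ U (x, o)) ∂μ :=
    fun y => integral_nonneg fun U => (Real.exp_pos _).le
  have hprod : ∏ y : Site 4 (2 * S + 1),
        ∫ U, Real.exp (-∑ x : Site 4 (2 * S + 1), c y * WilsonRP.plaqRe r.ρ U (x, o)) ∂μ ≤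
      (Real.exp (-(a * β * r.N * ((2 * S + 1 : ℕ) : ℝ) ^ 4)) *
          Real.exp (2 * a * A * ((2 * S + 1 : ℕ) : ℝ) ^ 4)) ^ Q.card := by
    refine (Finset.prod_le_prod (fun y _ => hRHS0 y) fun y _ => hRHS y).trans (le_of_eq ?_)
    rw [Finset.prod_ite_mem, Finset.univ_inter, Finset.prod_const]
  -- combine: `(e^{−aβN#Q} I)^{L⁴} ≤ (e^{(2aA − aβN)L⁴})^{#Q} = (e^{−aβN#Q} e^{2aA#Q})^{L⁴}`
  have hmain : (Real.exp (-(a * β * r.N * Q.card)) * I) ^ ((2 * S + 1) ^ 4) ≤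
      (Real.exp (-(a * β * r.N * Q.card)) * Real.exp (2 * a * A * Q.card)) ^ ((2 * S + 1) ^ 4) := by
    have h := hchess.trans hprod
    rw [hLHSint] at h
    refine h.trans (le_of_eq ?_)
    rw [← Real.exp_add, ← Real.exp_add, ← Real.exp_nat_mul, ← Real.exp_nat_mul]
    congr 1
    push_cast
    ring
  have hT0 : (2 * S + 1) ^ 4 ≠ 0 := pow_ne_zero _ (by omega)
  have hcancel := (pow_le_pow_iff_left₀ (mul_nonneg (Real.exp_pos _).le hI0)
    (mul_nonneg (Real.exp_pos _).le (Real.exp_pos _).le) hT0).1 hmain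
  have hIle : I ≤ Real.exp (2 * a * A * Q.card) := le_of_mul_le_mul_left hcancel (Real.exp_pos _)
  calc I ≤ Real.exp (2 * a * A * Q.card) := hIle
    _ = Real.exp (2 * A * a * Q.card) := by ring_nf

end Local

end Summit.QuantumFields.BalabanUV.T4Continuum.NE7b.LocalPlaquetteExpMoments

end
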